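import Mathlib
import HarnessLib
import Literature.MathematicalPhysics.QuantumLattice.SectorisedKernelNormExtraction

/-!
# Route `KLProgramme` — crux C4a, LAYER 2 of the tadpole representation, dictionary item (α), core: a momentum-space kernel of a Grassmann
# polynomial of the Hubbard torus IS a trigonometric polynomial of its momenta with POSITION-SPACE kernel coefficients; the two loop legs of the
# tadpole contribute the character `χ_{p⃗}(x⃗₃ − x⃗₂)` of the loop momentum

Cell `gate-hubbard-kl`, lane hubbard-kl-c4a-1 (g3); helper for stub (C) `stub_twoLeg_curvature` of the engine-flow child `KLRegimeEngineV17F2`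
(stmt-HubbardSuperconductivity-20437); memo HOME/hubbard-kl-c4a-1/C4A-PLAN.md §16.2 (α).  LAYER 1 (r2d-p1, `…KLRegimeSplitTwoLegIncrementRepReading`
§4 `klLocalPart_succ_sub_eq`) reads the scale-`n` increment through the four-leg momentum kernel at the legs `(k, σ, 0), (k, σ, 1), (p, τ, 1), (p, τ, 0)`,
summed over the loop label `p = (p₀, p⃗)`; LAYER 2's bridge `…C4aLatticeTubeAlias.norm_latticeTubeAvg_sub_tubeIntegral_le_of_trigPoly` wants the `p⃗`-dependence
as a trigonometric polynomial `Σ_y c_y·χ_{p⃗}(y)` with `Σ_y ‖c_y‖` a position-space kernel norm.  This file supplies the two dictionary facts, from the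
Fourier inversion of the sectorised kernels (Literature `SectorisedKernelNormExtraction.sum_sectorisedKernel_mul_conj_prod`, trivial multiplier):

* **`kernel_eq_invCard_mul_sum_positionKernel`** — `F_m((k_i,σ_i,c_i)_i) = |Λ|^{-m}·Σ_{x} W_m((x_i,σ_i,c_i)_i)·conj(∏_i e^{-is_{c_i}k_i·x_i})`
  (`|Λ| = 2M·L²`, `W_m = positionKernel`): every momentum kernel is a trigonometric polynomial of its momenta with the position kernels as coefficients;
  `norm_kernel_le_invCard_mul_sum_norm_positionKernel` — hence `‖F_m(k)‖ ≤ |Λ|^{-m}·Σ_x ‖W_m(x)‖` uniformly in the momenta;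
* **`conj_hubbardPlaneWave_one_mul_conj_hubbardPlaneWave_zero`** — the two LOOP legs `(p, ·, 1)` at `x₂` and `(p, ·, 0)` at `x₃` contribute
  `conj(e^{-is₁p·x₂})·conj(e^{-is₀p·x₃}) = e^{iω_p(t₃ − t₂)}·χ_{p⃗}(x⃗₃ − x⃗₂)` — a time phase (fixed at fixed Matsubara label) times ONE spatial character of the
  loop momentum at the DIFFERENCE of the two positions (so regrouping the `x`-sum by `y = x⃗₃ − x⃗₂` gives the trigonometric polynomial in `p⃗`, with
  `Σ_y ‖c_y‖ ≤ |Λ|^{-4}·Σ_x ‖W₄(x)‖` — the fiberwise regrouping and the `vertexFn` normalisation `𝒱₄ = 4!·ε^{-3}·F₄` are LAYER-2 proper).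

Exact identities / one triangle inequality; nothing is asserted about the Hubbard model's sizes.  References: BGM 2006 §2.1 (2.4)–(2.5), §2.3 (2.17),
§2.7 (2.70) [cite: BenfattoGiulianiMastropietro2006]; Salmhofer 1999 App. B.5.5 [cite: Salmhofer1999].
-/

noncomputable section

namespace Summit.HubbardSuperconductivity.HubbardSuperconductivity.Theorems.C4a

set_option linter.dupNamespace false -- summit = problem name (single-conjunct summit), D-0017

open Finset Literature.MathematicalPhysics.QuantumLattice Literature.Probability.LatticeModels GrassmannAlgebra

variable {L M : ℕ} [NeZero L]

/-! ## §1 Momentum kernels are trigonometric polynomials with position-kernel coefficients -/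

/-- **Fourier inversion solved for the momentum kernel** (trivial sectorisation):
`F_m((k_i,σ_i,c_i)_i) = |Λ|^{-m}·Σ_x W_m((x_i,σ_i,c_i)_i)·conj(∏_i e^{-is_{c_i}k_i·x_i})`. [cite: BenfattoGiulianiMastropietro2006, §2.7 (2.70)] -/
theorem kernel_eq_invCard_mul_sum_positionKernel [NeZero M] {β : ℝ} (hβ : β ≠ 0) (G : HubbardGrassmann L M) (m : ℕ) (σ c : Fin m → Fin 2)
    (k : Fin m → FreqMomentum L M) :
    kernel ℂ G m (fun i => ((k i, σ i), c i)) =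
      ((Fintype.card (SpaceTimeIdx L M) : ℂ) ^ m)⁻¹ *
        ∑ x : Fin m → SpaceTimeIdx L M, positionKernel L M β G m (fun i => ((x i, σ i), c i)) *
          (starRingEnd ℂ) (∏ i, hubbardPlaneWave L M β (c i) (k i) (x i)) := by
  have h := sum_sectorisedKernel_mul_conj_prod hβ (trivialMultiplier L M) G m (fun i => (((0 : Fin 1), σ i), c i)) k
  simp only [sectorisedKernel_trivialMultiplier, trivialMultiplier, prod_const_one, mul_one] at h
  have h2M : 0 < 2 * M := Nat.mul_pos two_pos (Nat.pos_of_ne_zero (NeZero.ne M))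
  haveI : Nonempty (SpaceTimeIdx L M) := ⟨(⟨0, h2M⟩, fun _ => 0)⟩
  have hcard : ((Fintype.card (SpaceTimeIdx L M) : ℂ) ^ m) ≠ 0 := by
    refine pow_ne_zero _ (Nat.cast_ne_zero.2 ?_)
    exact Fintype.card_ne_zero
  rw [h, ← mul_assoc, inv_mul_cancel₀ hcard, one_mul]

/-- **Uniform bound of a momentum kernel by the `L¹` mass of its position kernel**: `‖F_m(k)‖ ≤ |Λ|^{-m}·Σ_x ‖W_m(x)‖`.
[cite: BenfattoGiulianiMastropietro2006, §2.7 (2.70)] -/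
theorem norm_kernel_le_invCard_mul_sum_norm_positionKernel [NeZero M] {β : ℝ} (hβ : β ≠ 0) (G : HubbardGrassmann L M) (m : ℕ) (σ c : Fin m → Fin 2)
    (k : Fin m → FreqMomentum L M) :
    ‖kernel ℂ G m (fun i => ((k i, σ i), c i))‖ ≤
      ((Fintype.card (SpaceTimeIdx L M) : ℝ) ^ m)⁻¹ * ∑ x : Fin m → SpaceTimeIdx L M, ‖positionKernel L M β G m (fun i => ((x i, σ i), c i))‖ := by
  rw [kernel_eq_invCard_mul_sum_positionKernel hβ G m σ c k, norm_mul, norm_inv, norm_pow, Complex.norm_natCast]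
  refine mul_le_mul_of_nonneg_left ((norm_sum_le _ _).trans (sum_le_sum fun x _ => ?_)) (by positivity)
  rw [norm_mul, map_prod, norm_prod]
  refine mul_le_of_le_one_right (norm_nonneg _) (le_of_eq (prod_eq_one fun i _ => ?_))
  rw [Complex.norm_conj, norm_hubbardPlaneWave]

/-! ## §2 The two loop legs of the tadpole: a time phase times ONE spatial character at the position difference -/

/-- `conj (e^{r i}) = e^{-r i}` for real `r`. -/
private theorem conj_cexp_ofReal_mul_I (r : ℝ) : (starRingEnd ℂ) (Complex.exp ((r : ℂ) * Complex.I)) = Complex.exp (-((r : ℂ) * Complex.I)) := by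
  rw [← Complex.exp_conj, map_mul, Complex.conj_ofReal, Complex.conj_I, mul_neg]

/-- **The loop pair**: `conj(e^{-is₁ p·x₂})·conj(e^{-is₀ p·x₃}) = e^{iω_p(t₃ − t₂)}·χ_{p⃗}(x⃗₃ − x⃗₂)` — the charges `c = 1` (`s₁ = −1`) at `x₂` and `c = 0`
(`s₀ = +1`) at `x₃` of the slice line's two ends. [cite: BenfattoGiulianiMastropietro2006, §2.1 (2.4)–(2.5)] -/
theorem conj_hubbardPlaneWave_one_mul_conj_hubbardPlaneWave_zero (β : ℝ) (p : FreqMomentum L M) (x₂ x₃ : SpaceTimeIdx L M) :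
    (starRingEnd ℂ) (hubbardPlaneWave L M β 1 p x₂) * (starRingEnd ℂ) (hubbardPlaneWave L M β 0 p x₃) =
      Complex.exp (((matsubaraFreq β M p.1 * (imagTime β M x₃.1 - imagTime β M x₂.1) : ℝ) : ℂ) * Complex.I) *
        torusChar p.2 (x₃.2 - x₂.2) := by
  rw [hubbardPlaneWave_eq, hubbardPlaneWave_eq]
  simp only [chargeSign, Fin.one_eq_zero_iff, OfNat.ofNat_ne_one, if_false, if_true, map_mul, Complex.conj_conj]
  rw [torusChar_sub_right]
  -- the time phases
  have h1 : (starRingEnd ℂ) (Complex.exp (-((((-1 : ℝ) * (matsubaraFreq β M p.1 * imagTime β M x₂.1) : ℝ) : ℂ)) * Complex.I)) =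
      Complex.exp (-(((matsubaraFreq β M p.1 * imagTime β M x₂.1 : ℝ) : ℂ) * Complex.I)) := by
    rw [show -((((-1 : ℝ) * (matsubaraFreq β M p.1 * imagTime β M x₂.1) : ℝ) : ℂ)) * Complex.I =
        (((matsubaraFreq β M p.1 * imagTime β M x₂.1 : ℝ) : ℂ)) * Complex.I by push_cast; ring, conj_cexp_ofReal_mul_I]
  have h2 : (starRingEnd ℂ) (Complex.exp (-((((1 : ℝ) * (matsubaraFreq β M p.1 * imagTime β M x₃.1) : ℝ) : ℂ)) * Complex.I)) =
      Complex.exp ((((matsubaraFreq β M p.1 * imagTime β M x₃.1 : ℝ) : ℂ)) * Complex.I) := by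
    rw [show -((((1 : ℝ) * (matsubaraFreq β M p.1 * imagTime β M x₃.1) : ℝ) : ℂ)) * Complex.I =
        -((((matsubaraFreq β M p.1 * imagTime β M x₃.1 : ℝ) : ℂ)) * Complex.I) by push_cast; ring]
    rw [← Complex.exp_conj, map_neg, map_mul, Complex.conj_ofReal, Complex.conj_I, mul_neg, neg_neg]
  rw [h1, h2]
  rw [show (((matsubaraFreq β M p.1 * (imagTime β M x₃.1 - imagTime β M x₂.1) : ℝ) : ℂ)) * Complex.I =
      -((((matsubaraFreq β M p.1 * imagTime β M x₂.1 : ℝ) : ℂ)) * Complex.I) + (((matsubaraFreq β M p.1 * imagTime β M x₃.1 : ℝ) : ℂ)) * Complex.I by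
    push_cast; ring, Complex.exp_add]
  ring

/-! ## §3 The four-leg kernel at the tadpole legs as a trigonometric polynomial of the loop momentum -/

/-- **THE TADPOLE LEGS**: at the legs `(k,σ,0), (k,σ,1), ((p₀,q⃗),τ,1), ((p₀,q⃗),τ,0)` the four-leg momentum kernel is the trigonometric polynomial
`Σ_{y ∈ ℤ_L²} C(y)·χ_{q⃗}(y)` of the loop momentum `q⃗`, with
`C(y) = |Λ|^{-4}·Σ_{x : x⃗₃ − x⃗₂ = y} W₄(x)·conj(e^{-is₀k·x₀})·conj(e^{-is₁k·x₁})·e^{iω_{p₀}(t₃ − t₂)}` (`q⃗`-free). [cite: BenfattoGiulianiMastropietro2006, §2.3 (2.17)] -/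
theorem kernel_four_loop_eq_sum_torusChar [NeZero M] {β : ℝ} (hβ : β ≠ 0) (G : HubbardGrassmann L M) (k : FreqMomentum L M) (σ τ : Fin 2)
    (p₀ : MatsubaraIdx M) (q : TorusSite 2 L) :
    kernel ℂ G 4 (fun i => ((![k, k, (p₀, q), (p₀, q)] i, ![σ, σ, τ, τ] i), (![0, 1, 1, 0] : Fin 4 → Fin 2) i)) =
      ∑ y : TorusSite 2 L,
        (((Fintype.card (SpaceTimeIdx L M) : ℂ) ^ 4)⁻¹ *
          ∑ x ∈ (Finset.univ : Finset (Fin 4 → SpaceTimeIdx L M)).filter (fun x => (x 3).2 - (x 2).2 = y),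
            positionKernel L M β G 4 (fun i => ((x i, ![σ, σ, τ, τ] i), (![0, 1, 1, 0] : Fin 4 → Fin 2) i)) *
              ((starRingEnd ℂ) (hubbardPlaneWave L M β 0 k (x 0)) * (starRingEnd ℂ) (hubbardPlaneWave L M β 1 k (x 1)) *
                Complex.exp (((matsubaraFreq β M p₀ * (imagTime β M (x 3).1 - imagTime β M (x 2).1) : ℝ) : ℂ) * Complex.I))) *
          torusChar q y := by
  rw [kernel_eq_invCard_mul_sum_positionKernel hβ G 4]
  -- the product of the four conjugate plane waves: external pair × (time phase · character at the difference)
  have hprod : ∀ x : Fin 4 → SpaceTimeIdx L M,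
      (starRingEnd ℂ) (∏ i : Fin 4, hubbardPlaneWave L M β ((![0, 1, 1, 0] : Fin 4 → Fin 2) i) (![k, k, (p₀, q), (p₀, q)] i) (x i)) =
        ((starRingEnd ℂ) (hubbardPlaneWave L M β 0 k (x 0)) * (starRingEnd ℂ) (hubbardPlaneWave L M β 1 k (x 1)) *
          Complex.exp (((matsubaraFreq β M p₀ * (imagTime β M (x 3).1 - imagTime β M (x 2).1) : ℝ) : ℂ) * Complex.I)) *
          torusChar q ((x 3).2 - (x 2).2) := by
    intro x
    rw [Fin.prod_univ_four]
    show (starRingEnd ℂ) (hubbardPlaneWave L M β 0 k (x 0) * hubbardPlaneWave L M β 1 k (x 1) *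
        hubbardPlaneWave L M β 1 (p₀, q) (x 2) * hubbardPlaneWave L M β 0 (p₀, q) (x 3)) = _
    have h23 := conj_hubbardPlaneWave_one_mul_conj_hubbardPlaneWave_zero (L := L) (M := M) β (p₀, q) (x 2) (x 3)
    rw [map_mul, map_mul, map_mul,
      mul_assoc ((starRingEnd ℂ) (hubbardPlaneWave L M β 0 k (x 0)) * (starRingEnd ℂ) (hubbardPlaneWave L M β 1 k (x 1))), h23]
    ring
  simp_rw [hprod]
  -- regroup the position sum by the difference `y = x⃗₃ − x⃗₂`
  rw [← Finset.sum_fiberwise Finset.univ (fun x : Fin 4 → SpaceTimeIdx L M => (x 3).2 - (x 2).2)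
    (fun x => positionKernel L M β G 4 (fun i => ((x i, ![σ, σ, τ, τ] i), (![0, 1, 1, 0] : Fin 4 → Fin 2) i)) *
      (((starRingEnd ℂ) (hubbardPlaneWave L M β 0 k (x 0)) * (starRingEnd ℂ) (hubbardPlaneWave L M β 1 k (x 1)) *
          Complex.exp (((matsubaraFreq β M p₀ * (imagTime β M (x 3).1 - imagTime β M (x 2).1) : ℝ) : ℂ) * Complex.I)) *
        torusChar q ((x 3).2 - (x 2).2)))]
  rw [Finset.mul_sum]
  refine Finset.sum_congr rfl fun y _ => ?_
  rw [Finset.mul_sum, Finset.mul_sum, Finset.sum_mul]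
  refine Finset.sum_congr rfl fun x hx => ?_
  rw [Finset.mem_filter] at hx
  rw [hx.2]
  ring

/-- **The coefficients are summable against the position kernel's `L¹` mass**: `Σ_y ‖C(y)‖ ≤ |Λ|^{-4}·Σ_x ‖W₄(x)‖` (plane waves and time phases
are unimodular; the fibres `x⃗₃ − x⃗₂ = y` partition the position tuples). [cite: BenfattoGiulianiMastropietro2006, §2.3 (2.17)] -/
theorem sum_norm_loopCoeff_le {β : ℝ} (G : HubbardGrassmann L M) (k : FreqMomentum L M) (σ τ : Fin 2) (p₀ : MatsubaraIdx M) :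
    ∑ y : TorusSite 2 L,
        ‖((Fintype.card (SpaceTimeIdx L M) : ℂ) ^ 4)⁻¹ *
          ∑ x ∈ (Finset.univ : Finset (Fin 4 → SpaceTimeIdx L M)).filter (fun x => (x 3).2 - (x 2).2 = y),
            positionKernel L M β G 4 (fun i => ((x i, ![σ, σ, τ, τ] i), (![0, 1, 1, 0] : Fin 4 → Fin 2) i)) *
              ((starRingEnd ℂ) (hubbardPlaneWave L M β 0 k (x 0)) * (starRingEnd ℂ) (hubbardPlaneWave L M β 1 k (x 1)) *
                Complex.exp (((matsubaraFreq β M p₀ * (imagTime β M (x 3).1 - imagTime β M (x 2).1) : ℝ) : ℂ) * Complex.I))‖ ≤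
      ((Fintype.card (SpaceTimeIdx L M) : ℝ) ^ 4)⁻¹ *
        ∑ x : Fin 4 → SpaceTimeIdx L M, ‖positionKernel L M β G 4 (fun i => ((x i, ![σ, σ, τ, τ] i), (![0, 1, 1, 0] : Fin 4 → Fin 2) i))‖ := by
  have hunit : ∀ x : Fin 4 → SpaceTimeIdx L M,
      ‖(starRingEnd ℂ) (hubbardPlaneWave L M β 0 k (x 0)) * (starRingEnd ℂ) (hubbardPlaneWave L M β 1 k (x 1)) *
          Complex.exp (((matsubaraFreq β M p₀ * (imagTime β M (x 3).1 - imagTime β M (x 2).1) : ℝ) : ℂ) * Complex.I)‖ = 1 := by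
    intro x
    rw [norm_mul, norm_mul, Complex.norm_conj, Complex.norm_conj, norm_hubbardPlaneWave, norm_hubbardPlaneWave, Complex.norm_exp_ofReal_mul_I]
    norm_num
  calc ∑ y : TorusSite 2 L,
        ‖((Fintype.card (SpaceTimeIdx L M) : ℂ) ^ 4)⁻¹ *
          ∑ x ∈ (Finset.univ : Finset (Fin 4 → SpaceTimeIdx L M)).filter (fun x => (x 3).2 - (x 2).2 = y),
            positionKernel L M β G 4 (fun i => ((x i, ![σ, σ, τ, τ] i), (![0, 1, 1, 0] : Fin 4 → Fin 2) i)) *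
              ((starRingEnd ℂ) (hubbardPlaneWave L M β 0 k (x 0)) * (starRingEnd ℂ) (hubbardPlaneWave L M β 1 k (x 1)) *
                Complex.exp (((matsubaraFreq β M p₀ * (imagTime β M (x 3).1 - imagTime β M (x 2).1) : ℝ) : ℂ) * Complex.I))‖
      ≤ ∑ y : TorusSite 2 L, ((Fintype.card (SpaceTimeIdx L M) : ℝ) ^ 4)⁻¹ *
          ∑ x ∈ (Finset.univ : Finset (Fin 4 → SpaceTimeIdx L M)).filter (fun x => (x 3).2 - (x 2).2 = y),
            ‖positionKernel L M β G 4 (fun i => ((x i, ![σ, σ, τ, τ] i), (![0, 1, 1, 0] : Fin 4 → Fin 2) i))‖ := by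
        refine Finset.sum_le_sum fun y _ => ?_
        rw [norm_mul, norm_inv, norm_pow, Complex.norm_natCast]
        refine mul_le_mul_of_nonneg_left ((norm_sum_le _ _).trans (Finset.sum_le_sum fun x _ => ?_)) (by positivity)
        rw [norm_mul, hunit, mul_one]
    _ = ((Fintype.card (SpaceTimeIdx L M) : ℝ) ^ 4)⁻¹ *
          ∑ x : Fin 4 → SpaceTimeIdx L M, ‖positionKernel L M β G 4 (fun i => ((x i, ![σ, σ, τ, τ] i), (![0, 1, 1, 0] : Fin 4 → Fin 2) i))‖ := by
        rw [← Finset.mul_sum, Finset.sum_fiberwise Finset.univ (fun x : Fin 4 → SpaceTimeIdx L M => (x 3).2 - (x 2).2)]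

/-! ## §4 LAYER 1's loop sum: the slice weight against the four-leg VERTEX FUNCTION at the tadpole legs, regrouped as
`Σ_{p₀,τ,y} C(y)·S_{p₀}(y)` with `S_{p₀}(y) = Σ_{q⃗} s(p₀,q⃗)·χ_{q⃗}(y)` the lattice Fourier transform of the slice weight (external-momentum FREE) -/

/-- Rearrangement: `Σ_q S(q)·(K·Σ_y C(y)χ(q,y)) = K·Σ_y C(y)·Σ_q S(q)χ(q,y)`. -/
private theorem sum_mul_mul_sum_rearrange {Q Y : Type*} [Fintype Q] [Fintype Y] (S : Q → ℂ) (C : Y → ℂ) (χ : Q → Y → ℂ) (K : ℂ) :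
    ∑ q, S q * (K * ∑ y, C y * χ q y) = K * ∑ y, C y * ∑ q, S q * χ q y := by
  simp only [Finset.mul_sum]
  rw [Finset.sum_comm]
  exact Finset.sum_congr rfl fun y _ => Finset.sum_congr rfl fun q _ => by ring

omit [NeZero L] in
/-- LAYER 1's leg string `(k,σ,0), (k,σ,1), (p,1), (p,0)` (`…TwoLegIncrementRepReading` §4, `Fin.snoc` form) in the coordinate form of §3. -/
theorem tadpoleLegs_snoc_eq (k : FreqMomentum L M) (σ : Fin 2) (p : FreqMomentum L M × Fin 2) :
    (Fin.snoc (Fin.snoc (![((k, σ), 0), ((k, σ), 1)] : Fin 2 → HubbardFieldIdx L M) ((p, 1) : HubbardFieldIdx L M) :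
        Fin (2 + 1) → HubbardFieldIdx L M) (p, 0) : Fin 4 → HubbardFieldIdx L M) =
      fun i => ((![k, k, p.1, p.1] i, ![σ, σ, p.2, p.2] i), (![0, 1, 1, 0] : Fin 4 → Fin 2) i) := by
  funext i
  fin_cases i <;> rfl

/-- **THE LOOP SUM REGROUPED.**  For any slice weight `s` on the loop label and the four-leg vertex function `𝒱₄ = 4!·(βL²)³·F₄` at the tadpole legs:
`Σ_{p=((p₀,q⃗),τ)} s(p₀,q⃗)·𝒱₄((k,σ,0),(k,σ,1),(p,1),(p,0)) = 4!(βL²)³·Σ_{p₀,τ,y} C(y)·Σ_{q⃗} s(p₀,q⃗)χ_{q⃗}(y)` — the loop momentum now enters ONLY through the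
lattice Fourier transform of the slice weight, the object Poisson summation (…C4aLatticeTubeAlias) acts on. [cite: BenfattoGiulianiMastropietro2006, §2.3 (2.17)] -/
theorem sum_slice_mul_vertexFn_tadpoleLegs_eq [NeZero M] {β : ℝ} (hβ : β ≠ 0) (G : HubbardGrassmann L M) (k : FreqMomentum L M) (σ : Fin 2)
    (s : FreqMomentum L M → ℂ) :
    ∑ p : FreqMomentum L M × Fin 2, s p.1 * vertexFn L M β G (2 + 2)
        (Fin.snoc (Fin.snoc (![((k, σ), 0), ((k, σ), 1)] : Fin 2 → HubbardFieldIdx L M) ((p, 1) : HubbardFieldIdx L M) :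
          Fin (2 + 1) → HubbardFieldIdx L M) (p, 0)) =
      ((((4 : ℕ).factorial : ℝ) * (β * (L : ℝ) ^ 2) ^ (4 - 1) : ℝ) : ℂ) *
        ∑ p₀ : MatsubaraIdx M, ∑ τ : Fin 2, ∑ y : TorusSite 2 L,
          (((Fintype.card (SpaceTimeIdx L M) : ℂ) ^ 4)⁻¹ *
            ∑ x ∈ (Finset.univ : Finset (Fin 4 → SpaceTimeIdx L M)).filter (fun x => (x 3).2 - (x 2).2 = y),
              positionKernel L M β G 4 (fun i => ((x i, ![σ, σ, τ, τ] i), (![0, 1, 1, 0] : Fin 4 → Fin 2) i)) *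
                ((starRingEnd ℂ) (hubbardPlaneWave L M β 0 k (x 0)) * (starRingEnd ℂ) (hubbardPlaneWave L M β 1 k (x 1)) *
                  Complex.exp (((matsubaraFreq β M p₀ * (imagTime β M (x 3).1 - imagTime β M (x 2).1) : ℝ) : ℂ) * Complex.I))) *
          ∑ q : TorusSite 2 L, s (p₀, q) * torusChar q y := by
  -- coordinate form of the legs and the vertex-function normalisation
  have hV : ∀ p : FreqMomentum L M × Fin 2, vertexFn L M β G (2 + 2)
      (Fin.snoc (Fin.snoc (![((k, σ), 0), ((k, σ), 1)] : Fin 2 → HubbardFieldIdx L M) ((p, 1) : HubbardFieldIdx L M) :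
        Fin (2 + 1) → HubbardFieldIdx L M) (p, 0)) =
      ((((4 : ℕ).factorial : ℝ) * (β * (L : ℝ) ^ 2) ^ (4 - 1) : ℝ) : ℂ) *
        kernel ℂ G 4 (fun i => ((![k, k, p.1, p.1] i, ![σ, σ, p.2, p.2] i), (![0, 1, 1, 0] : Fin 4 → Fin 2) i)) := by
    intro p
    rw [vertexFn_def]
    exact congrArg _ (congrArg (kernel ℂ G 4) (tadpoleLegs_snoc_eq k σ p))
  simp_rw [hV]
  -- split the loop label `p = ((p₀, q⃗), τ)`
  rw [Fintype.sum_prod_type, Fintype.sum_prod_type, Finset.mul_sum]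
  refine Finset.sum_congr rfl fun p₀ _ => ?_
  -- insert the trigonometric-polynomial form of §3 and rearrange
  have hk : ∀ (q : TorusSite 2 L) (τ : Fin 2),
      kernel ℂ G 4 (fun i => ((![k, k, (p₀, q), (p₀, q)] i, ![σ, σ, τ, τ] i), (![0, 1, 1, 0] : Fin 4 → Fin 2) i)) = _ :=
    fun q τ => kernel_four_loop_eq_sum_torusChar hβ G k σ τ p₀ q
  simp only [hk]
  rw [Finset.sum_comm, Finset.mul_sum]
  refine Finset.sum_congr rfl fun τ _ => ?_
  exact sum_mul_mul_sum_rearrange (fun q : TorusSite 2 L => s (p₀, q)) _ (fun (q : TorusSite 2 L) (y : TorusSite 2 L) => torusChar q y) _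

/-! ## §5 Towards the continuum: the external pair, and characters as plane waves with CENTRED integer frequencies -/

/-- **The external pair** at a common label `k`: `conj(e^{-is₀k·x₀})·conj(e^{-is₁k·x₁}) = e^{iω_k(t₀ − t₁)}·χ_{k⃗}(x⃗₀ − x⃗₁)` — so the coefficients `C(y)`
of §3 are themselves trigonometric polynomials of the EXTERNAL momentum `k⃗` (the reading is a trigonometric polynomial in `k⃗`, on which `symInterp` is exact).
[cite: BenfattoGiulianiMastropietro2006, §2.1 (2.4)–(2.5)] -/
theorem conj_hubbardPlaneWave_zero_mul_conj_hubbardPlaneWave_one (β : ℝ) (k : FreqMomentum L M) (x₀ x₁ : SpaceTimeIdx L M) :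
    (starRingEnd ℂ) (hubbardPlaneWave L M β 0 k x₀) * (starRingEnd ℂ) (hubbardPlaneWave L M β 1 k x₁) =
      Complex.exp (((matsubaraFreq β M k.1 * (imagTime β M x₀.1 - imagTime β M x₁.1) : ℝ) : ℂ) * Complex.I) *
        torusChar k.2 (x₀.2 - x₁.2) := by
  rw [mul_comm, conj_hubbardPlaneWave_one_mul_conj_hubbardPlaneWave_zero β k x₁ x₀]

/-- **A character of the dual torus is a plane wave with the CENTRED integer frequency**: `χ_{k⃗}(x) = exp(i Σ_i p_{k⃗,i}·x̃_i)`, `x̃_i = valMinAbs (x i)`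
(`p_{k⃗,i}·L ∈ 2πℤ`, so the representative may be centred). [cite: BenfattoGiulianiMastropietro2006, §2.1 (2.3)] -/
theorem torusChar_eq_cexp_valMinAbs (k x : TorusSite 2 L) :
    torusChar k x = Complex.exp (((∑ i, latticeMomentum L k i * ((x i).valMinAbs : ℝ) : ℝ) : ℂ) * Complex.I) := by
  rw [← cexp_sum_latticeMomentum_mul_eq_torusChar]
  -- per coordinate the two phases differ by an integer multiple of `2π`
  have hL : (L : ℝ) ≠ 0 := Nat.cast_ne_zero.2 (NeZero.ne L)
  have hi : ∀ i, ∃ m : ℤ, latticeMomentum L k i * ((x i).val : ℝ) =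
      latticeMomentum L k i * ((x i).valMinAbs : ℝ) + (m : ℝ) * (2 * Real.pi) := by
    intro i
    have hdvd : (L : ℤ) ∣ ((x i).val : ℤ) - (x i).valMinAbs := by
      rw [← ZMod.intCast_zmod_eq_zero_iff_dvd]
      push_cast
      simp
    obtain ⟨m, hm⟩ := hdvd
    refine ⟨((k i).val : ℤ) * m, ?_⟩
    have hm' : ((x i).val : ℝ) = ((x i).valMinAbs : ℝ) + (L : ℝ) * (m : ℝ) := by
      have := congrArg (fun z : ℤ => (z : ℝ)) hm
      push_cast at this
      linarith
    have hkey : latticeMomentum L k i * ((L : ℝ) * (m : ℝ)) = ((((k i).val : ℤ) * m : ℤ) : ℝ) * (2 * Real.pi) := by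
      unfold latticeMomentum
      push_cast
      calc 2 * Real.pi * ((k i).val : ℝ) / L * ((L : ℝ) * (m : ℝ)) = (2 * Real.pi * ((k i).val : ℝ) / L * L) * m := by ring
        _ = 2 * Real.pi * ((k i).val : ℝ) * m := by rw [div_mul_cancel₀ _ hL]
        _ = ((k i).val : ℝ) * (m : ℝ) * (2 * Real.pi) := by ring
    rw [hm', mul_add, hkey]
  choose m hm using hi
  simp_rw [hm]
  rw [sum_add_distrib, ← sum_mul, show (∑ i, (m i : ℝ)) = ((∑ i, m i : ℤ) : ℝ) by push_cast; rfl]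
  push_cast
  rw [add_mul, Complex.exp_add]
  have h1 : Complex.exp ((∑ i, (m i : ℂ)) * (2 * (Real.pi : ℂ)) * Complex.I) = 1 := by
    rw [show (∑ i, (m i : ℂ)) * (2 * (Real.pi : ℂ)) * Complex.I = ((∑ i, m i : ℤ) : ℂ) * (2 * Real.pi * Complex.I) by push_cast; ring]
    exact Complex.exp_int_mul_two_pi_mul_I _
  rw [h1, mul_one]

/-- **The centred frequencies sit in the closed half box**: `2·|x̃_i| ≤ L`. [cite: BenfattoGiulianiMastropietro2006, §2.1 (2.3)] -/
theorem two_mul_abs_valMinAbs_le (x : TorusSite 2 L) (i : Fin 2) : 2 * |((x i).valMinAbs : ℤ)| ≤ (L : ℤ) := by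
  have h := ZMod.natAbs_valMinAbs_le (x i)
  have h2 : (((x i).valMinAbs.natAbs : ℕ) : ℤ) = |((x i).valMinAbs : ℤ)| := Int.natCast_natAbs _
  have h3 : 2 * ((x i).valMinAbs.natAbs : ℤ) ≤ (L : ℤ) := by
    have : 2 * (x i).valMinAbs.natAbs ≤ L := by omega
    exact_mod_cast this
  rwa [h2] at h3

end Summit.HubbardSuperconductivity.HubbardSuperconductivity.Theorems.C4a

end
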